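import Summits.HodgeConjecture.HodgeConjecture.Theorems.HeckePrymWeilHeckePrymAnchorsOfStubs
import Summits.HodgeConjecture.HodgeConjecture.Theorems.HeckePrymWeilHeckePrymAnchorsUpgrade
import Summits.HodgeConjecture.HodgeConjecture.Theorems.HeckePrymWeilHeckePrymAnchorsRationalAlongSection
import Summits.HodgeConjecture.HodgeConjecture.Theorems.HeckePrymWeilHeckePrymAnchorsGlobalClassOfLeray
import Summits.HodgeConjecture.HodgeConjecture.Theses.AnchorTransport
import Literature.AlgebraicGeometry.HodgeTheory.InvariantClassesFromTotalSpace
import Literature.AlgebraicGeometry.HodgeTheory.WeilFamilyFlatSections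
import HarnessLib

/-!
# `HyperbolicEightfoldsSqrtMinus7` modulo two named facts and the transport step (item stmt-HodgeConjecture-14642, route HeckePrymWeil)

Line `Sketch` of crux `HeckePrymWeil.HyperbolicEightfoldsSqrtMinus7`, skeleton v6 (continuation lead c3,
2026-08-16): the ANCHOR SWAP. Up to v5.1 the line reached the split `ℚ(√-7)`-Weil eightfold `A` from the
DICYCLIC anchor (the `(−1,−3)_ℚ`-isotypic Prym of an étale `Dic₃`-cover, Schoen 1988 + the quaternion field
switch), at the price of a reach stub nobody can formalise (PEL moduli + Riemann existence + a computed
discriminant). Since 13:46Z the tree holds Deligne's Weil family as an ACCEPTED named fact,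
`HodgeTheory.deligne1982_weilFamily_hodgeWeilSection` (LNM 900, proof of Thm. 4.8 with Prop. 4.4; van Geemen
LNM 1594 §5; André 1996 Lemme 6.3.3): through EVERY `√-p`-abelian `2k`-fold `(X, Φ)` and every non-zero
rational `(k,k)` class `c` of its strong Weil plane there is an embedded smooth projective family over a
smooth irreducible quasi-projective base with a flat, fibrewise Hodge, Weil section `σ` through `c` and a
fibre `K`-isogenous to a TENSOR POINT `(A₁ × A₁, companion)`, at which the Weil plane is algebraic by
Deligne's Lemma 4.5 / Remark 4.10 — PROVED in the tree (`HeckePrymWeilLine.owf_anchorAlgebraic` =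
`stub_pointClassAnchor` across `stub_isogenyTransfer`). With the proved typing upgrade
`HeckePrymWeilLine.stub_upgrade` (the crux's single-operator plane `Eig((𝟙+φ)^*, (1±i√7)⁸)` lies in
`weilClassesOf A φ 4 7`), the proved rationality along flat sections `stub_rationalAlongSection`, the
W-engine `stub_globalClassOfSection_of_leray` (Deligne 1968 at one point + identity principle) and the
route's proved `IsoInvariance`, the crux for eightfolds becomes:

* `hyperbolicEightfoldsSqrtMinus7_of_engine_of_weilFamily_of_transport` — the COMPOSITION from three
  hypotheses spelled out / named: the W-engine `hG` (same shape as the sibling crux's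
  `heckePrymAnchors_of_sections`), the Weil-family fact `hWF` BY NAME, and `hT` = TENSOR-ANCHORED WEIL
  TRANSPORT IN DIMENSION 8: along an embedded smooth projective family of `√-7`-eightfolds over a smooth
  irreducible quasi-projective base, a global class that is fibrewise rational of type `(4,4)` and
  algebraic at a fibre `K`-isogenous to a tensor point (where it lies in the strong Weil plane) is
  algebraic on every fibre — exactly the shape of Markman's theorem one dimension lower
  ([Markman2025SecantWeil, Thm. 1.5.1]: sixfolds, deformation of secant sheaves from `X × X̂`), OPEN in
  dimension 8 ([Markman2025SecantWeil, §1.2]: the secant variety of the even spinor variety is proper for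
  `n ≥ 4`); it is the registered `stub_transport` of skeleton v6;
* `tensorTransport_of_weilVariationalHodge`, `tensorTransport_of_anchorTransport` — `hT` is an instance of
  the route crux `WeilVariationalHodge` (stmt-HodgeConjecture-14497) at `(p, M) = (7, 4)` and of
  `AnchorTransport.VariationalHodge` (stmt-HodgeConjecture-1076) at `p = 4`;
* `hyperbolicEightfoldsSqrtMinus7_of_two_facts_of_weilVariationalHodge` — the crux from THREE EXISTING
  DECLARATIONS of the tree and nothing else: the accepted named facts
  `deligne1968_invariantClass_fromTotalSpace`, `deligne1982_weilFamily_hodgeWeilSection` and the route crux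
  `WeilVariationalHodge`; likewise `…_of_anchorTransport`.

The hyperbolicity hypothesis of the crux (and `e`, `a`) is not consumed: the Weil-family fact reaches a
tensor-isogenous CM fibre in every component (André, Lemme 6.3.3), so the argument proves the stronger
all-discriminant statement `RungEight` of `Cruxes/HyperbolicEightfoldsSqrtMinus7/Disproof.lean` §1 from
the same three inputs (`rungEight`-shape theorem `weilEightfolds_of_engine_of_weilFamily_of_transport`).
CONDITIONAL results; no definition, no `sorry`.
-/

noncomputable section

-- single-problem summit (Problem = Summit): the mandated namespace repeats `HodgeConjecture`.
set_option linter.dupNamespace false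

open CategoryTheory AlgebraicGeometry Limits MonoidalCategory CartesianMonoidalCategory
open Literature.AlgebraicGeometry Literature.AlgebraicGeometry.Motives
  Literature.AlgebraicGeometry.HodgeTheory
open Summit.HodgeConjecture.HodgeConjecture.Theorems.HeckePrymWeilLine
  (stub_upgrade stub_rationalAlongSection stub_globalClassOfSection_of_leray owf_isoTransport
    owf_anchorAlgebraic)

namespace Summit.HodgeConjecture.HodgeConjecture.Theorems.HyperbolicEightfoldsSqrtMinus7.TensorAnchor

/-- **All `√-7`-Weil eightfolds from the W-engine, Deligne's Weil family and tensor-anchored transport**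
(the composition of skeleton v6 with the crux's idle hypotheses dropped: every rational `(4,4)` class of
the typed Weil plane of ANY complex abelian eightfold `A` with `φ ≫ φ = -7` is algebraic). `hG`: every
continuous section of `FiberClass f k → S(ℂ)` of an embedded smooth projective family over a smooth
quasi-projective irreducible base is the global section of one class of the open total space. `hWF`:
the named fact `deligne1982_weilFamily_hodgeWeilSection`. `hT`: tensor-anchored Weil transport in
dimension 8 (module docstring). Proof: `c = 0` is algebraic; otherwise upgrade `c` to the strong Weil
plane (`stub_upgrade`), take the Weil family `f : 𝒳 → S` through `A` with its flat fibrewise-Hodge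
section `σ` through `c` and its tensor-isogenous fibre `Y ≅ 𝒳_{s₀}` (`hWF` at `(p, k) = (7, 4)`),
globalise `σ` to one class `W` (`hG`), read rationality of `W|_{𝒳_s}` from `stub_rationalAlongSection`
and Hodge type from the family, algebraicity of `W|_{𝒳_{s₀}}` from `owf_anchorAlgebraic` through
`owf_isoTransport`, transport it to `s₁` (`hT`), and pull back along `e : A ≅ 𝒳_{s₁}` (`IsoInvariance`).
[cite: Deligne1982HodgeCycles, proof of Thm. 4.8 (pp. 47–52), Prop. 4.4, Lemma 4.5, Remark 4.10]
[cite: vanGeemen1994HodgeAV, §5.3–5.11] [cite: Andre1996Motifs, Lemme 6.3.3]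
[cite: Markman2025SecantWeil, Thm. 1.5.1 and §1.2] -/
theorem weilEightfolds_of_engine_of_weilFamily_of_transport
    (hG : ∀ ⦃𝒳 S : SchemeOver ℂ⦄ (f : 𝒳 ⟶ S) (n k : ℕ), IsSmoothProjectiveFamily f n →
      (∃ (N : ℕ) (ι : 𝒳 ⟶ projectiveSpace N ℂ ⊗ S),
          IsClosedImmersion ι.left ∧ ι ≫ snd (projectiveSpace N ℂ) S = f) →
      AlgebraicGeometry.Smooth S.hom → IsQuasiProjectiveOver S → IrreducibleSpace S.left →
      ∀ (σ : ComplexPoints S → FiberClass f k), Continuous σ → (∀ s, (σ s).pt = s) →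
        ∃ W : complexBetti 𝒳 k, ∀ s, σ s = globalSection f k W s)
    (hWF : deligne1982_weilFamily_hodgeWeilSection)
    (hT : ∀ ⦃𝒳 S : SchemeOver ℂ⦄ (f : 𝒳 ⟶ S), IsSmoothProjectiveFamily f 8 →
      (∃ (N : ℕ) (ι : 𝒳 ⟶ projectiveSpace N ℂ ⊗ S),
          IsClosedImmersion ι.left ∧ ι ≫ snd (projectiveSpace N ℂ) S = f) →
      IrreducibleSpace S.left → AlgebraicGeometry.Smooth S.hom → IsQuasiProjectiveOver S →
      ∀ (W : complexBetti 𝒳 8),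
        (∀ s : ComplexPoints S, IsRationalClass (complexBetti.map (fiberι f s) 8 W) ∧
          IsOfHodgeType 8 (fiberOver f s) 8 4 4 (complexBetti.map (fiberι f s) 8 W)) →
        (∀ s : ComplexPoints S, ∃ (A' : AbelianVariety ℂ) (φ' : A' ⟶ A'),
          A'.dim = 8 ∧ φ' ≫ φ' = -((7 : ℤ) • 𝟙 A') ∧ Nonempty (A'.X ≅ fiberOver f s)) →
        ∀ s₀ : ComplexPoints S,
          (∃ (Y : AbelianVariety ℂ) (Ψ : Y ⟶ Y) (e₀ : Y.X ≅ fiberOver f s₀) (A₁ : AbelianVariety ℂ)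
              (f₁ : Y ⟶ A₁.prod A₁) (g₁ : A₁.prod A₁ ⟶ Y) (m : ℕ),
            A₁.dim = 4 ∧ Y.dim = 8 ∧ Ψ ≫ Ψ = -((7 : ℤ) • 𝟙 Y) ∧ 0 < m ∧ f₁ ≫ g₁ = m • 𝟙 Y ∧
              Flat f₁.hom.hom.hom.left ∧
              g₁ ≫ Ψ = AbelianVariety.prodLift (AbelianVariety.snd A₁ A₁ ≫ (-((7 : ℤ) • 𝟙 A₁)))
                (AbelianVariety.fst A₁ A₁) ≫ g₁ ∧
              complexBetti.map e₀.hom 8 (complexBetti.map (fiberι f s₀) 8 W) ∈ weilClassesOf Y Ψ 4 7) →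
          complexBetti.map (fiberι f s₀) 8 W ∈ algebraicClasses (fiberOver f s₀) 4 →
          ∀ s : ComplexPoints S, complexBetti.map (fiberι f s) 8 W ∈ algebraicClasses (fiberOver f s) 4) :
    ∀ (A : AbelianVariety ℂ) (φ : A ⟶ A), A.dim = 8 → φ ≫ φ = -((7 : ℤ) • 𝟙 A) →
      ∀ c : complexBetti A.X 8, IsRationalClass c → IsOfHodgeType 8 A.X 8 4 4 c →
        c ∈ Module.End.eigenspace (complexBetti.map (𝟙 A + φ).hom.hom.hom 8).hom
              ((1 + Complex.I * (Real.sqrt (7 : ℝ) : ℂ)) ^ 8) ⊔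
            Module.End.eigenspace (complexBetti.map (𝟙 A + φ).hom.hom.hom 8).hom
              ((1 - Complex.I * (Real.sqrt (7 : ℝ) : ℂ)) ^ 8) →
        c ∈ algebraicClasses A.X 4 := by
  intro A φ hA hφ c hr hH hW
  by_cases hc : c = 0
  · rw [hc]
    exact Submodule.zero_mem _
  -- casts: the named facts are stated for a variable prime `p`, here `p = 7`, and at degree `2 * 4`
  have hφ' : φ ≫ φ = -(((7 : ℕ) : ℤ) • 𝟙 A) := by exact_mod_cast hφ
  have hA' : A.dim = 2 * 4 := hA
  -- typing upgrade: the single-operator plane lies in the strong Weil plane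
  have hcW : c ∈ weilClassesOf A φ 4 7 := by
    refine stub_upgrade 7 (by norm_num) (by norm_num) le_rfl 4 A φ hA' hφ' ?_
    exact_mod_cast hW
  -- Deligne's Weil family through `A`, flat fibrewise-Hodge Weil section through `c`, tensor fibre
  obtain ⟨𝒳, S, f, s₁, s₀, e, σ, hfam, hι, hirr, hsm, hSqp, hfib, hσ, hpt, hHσ, hs₁, Y, Ψ, e₀, x,
    ⟨A₁, f₁, g₁, m, hA₁, hY, hΨ, hm, hfg, hf, hg⟩, hs₀, hx⟩ :=
    hWF 7 (by norm_num) (by norm_num) le_rfl 4 (by norm_num) A φ hA' hφ' c hcW hc hr hH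
  -- the global class of the section (W-engine)
  obtain ⟨W, hWσ⟩ := hG f (2 * 4) (2 * 4) hfam hι hsm hSqp hirr σ hσ hpt
  have hcls : ∀ (s : ComplexPoints S) (y : complexBetti (fiberOver f s) (2 * 4)),
      σ s = ⟨s, y⟩ → complexBetti.map (fiberι f s) (2 * 4) W = y := by
    intro s y hy
    have h := (hWσ s).symm.trans hy
    simp only [globalSection, FiberClass.mk.injEq, heq_eq_eq, true_and] at h
    exact h
  have hW₁ : complexBetti.map (fiberι f s₁) (2 * 4) W = complexBetti.map e.inv (2 * 4) c :=
    hcls s₁ _ hs₁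
  have hW₀ : complexBetti.map (fiberι f s₀) (2 * 4) W = x := hcls s₀ x hs₀
  -- rationality along the section (proved), Hodge type from the family's clause (a)
  have hrat₁ : IsRationalClass (σ s₁).cls := by
    rw [hs₁]; exact hr.map _
  have hratσ : ∀ s, IsRationalClass (σ s).cls :=
    stub_rationalAlongSection f (2 * 4) (2 * 4) hfam hsm hSqp hirr σ hσ hpt s₁ hrat₁
  have hfibre : ∀ s : ComplexPoints S,
      IsRationalClass (complexBetti.map (fiberι f s) (2 * 4) W) ∧
      IsOfHodgeType (2 * 4) (fiberOver f s) (2 * 4) 4 4 (complexBetti.map (fiberι f s) (2 * 4) W) := by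
    intro s
    have h₁ := hratσ s
    have h₂ := hHσ s
    rw [hWσ s] at h₁ h₂
    exact ⟨h₁, h₂⟩
  -- every fibre is a `√-7`-eightfold
  have hfib' : ∀ s : ComplexPoints S, ∃ (A' : AbelianVariety ℂ) (φ' : A' ⟶ A'),
      A'.dim = 8 ∧ φ' ≫ φ' = -((7 : ℤ) • 𝟙 A') ∧ Nonempty (A'.X ≅ fiberOver f s) := by
    intro s
    obtain ⟨A', φ', h1, h2, h3⟩ := hfib s
    exact ⟨A', φ', h1, by exact_mod_cast h2, h3⟩
  -- the anchor: the strong Weil plane of the tensor-isogenous fibre is algebraic (Deligne 4.5 / 4.10)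
  have h0 : complexBetti.map (fiberι f s₀) (2 * 4) W ∈ algebraicClasses (fiberOver f s₀) 4 := by
    rw [hW₀]
    exact owf_isoTransport _ Y e₀ 4 x
      (owf_anchorAlgebraic (by norm_num) (by norm_num) le_rfl A₁ f₁ g₁ m hA₁ hY hΨ hm hfg hf hg hx)
  -- transport from the anchor fibre to `s₁`
  have hanchor : ∃ (Y : AbelianVariety ℂ) (Ψ : Y ⟶ Y) (e₀ : Y.X ≅ fiberOver f s₀)
      (A₁ : AbelianVariety ℂ) (f₁ : Y ⟶ A₁.prod A₁) (g₁ : A₁.prod A₁ ⟶ Y) (m : ℕ),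
      A₁.dim = 4 ∧ Y.dim = 8 ∧ Ψ ≫ Ψ = -((7 : ℤ) • 𝟙 Y) ∧ 0 < m ∧ f₁ ≫ g₁ = m • 𝟙 Y ∧
        Flat f₁.hom.hom.hom.left ∧
        g₁ ≫ Ψ = AbelianVariety.prodLift (AbelianVariety.snd A₁ A₁ ≫ (-((7 : ℤ) • 𝟙 A₁)))
          (AbelianVariety.fst A₁ A₁) ≫ g₁ ∧
        complexBetti.map e₀.hom 8 (complexBetti.map (fiberι f s₀) 8 W) ∈ weilClassesOf Y Ψ 4 7 := by
    refine ⟨Y, Ψ, e₀, A₁, f₁, g₁, m, hA₁, hY, by exact_mod_cast hΨ, hm, hfg, hf, by exact_mod_cast hg,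
      ?_⟩
    have hx' : complexBetti.map e₀.hom (2 * 4) (complexBetti.map (fiberι f s₀) (2 * 4) W) ∈
        weilClassesOf Y Ψ 4 7 := by
      rw [hW₀]; exact hx
    exact hx'
  have h1 : complexBetti.map (fiberι f s₁) (2 * 4) W ∈ algebraicClasses (fiberOver f s₁) 4 :=
    hT f hfam hι hirr hsm hSqp W hfibre hfib' s₀ hanchor h0 s₁
  -- back along `e : A ≅ 𝒳_{s₁}` (the route's proved `IsoInvariance`)
  have key := Theorems.isoInvariance_proof e 4 _ h1
  rw [hW₁, ← CategoryTheory.comp_apply, ← complexBetti.map_comp, Iso.hom_inv_id,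
    complexBetti.map_id] at key
  exact key

/-- **`HyperbolicEightfoldsSqrtMinus7` from the W-engine, Deligne's Weil family and tensor-anchored
transport** (skeleton v6 of line `Sketch`, composition closing the crux BY NAME): the crux is the
hyperbolic case of `weilEightfolds_of_engine_of_weilFamily_of_transport` (its embedding, `a ≠ 0` and
hyperbolicity hypotheses are idle). [cite: Deligne1982HodgeCycles, proof of Thm. 4.8 (pp. 47–52)]
[cite: Markman2025SecantWeil, §1.2] -/
theorem hyperbolicEightfoldsSqrtMinus7_of_engine_of_weilFamily_of_transport
    (hG : ∀ ⦃𝒳 S : SchemeOver ℂ⦄ (f : 𝒳 ⟶ S) (n k : ℕ), IsSmoothProjectiveFamily f n →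
      (∃ (N : ℕ) (ι : 𝒳 ⟶ projectiveSpace N ℂ ⊗ S),
          IsClosedImmersion ι.left ∧ ι ≫ snd (projectiveSpace N ℂ) S = f) →
      AlgebraicGeometry.Smooth S.hom → IsQuasiProjectiveOver S → IrreducibleSpace S.left →
      ∀ (σ : ComplexPoints S → FiberClass f k), Continuous σ → (∀ s, (σ s).pt = s) →
        ∃ W : complexBetti 𝒳 k, ∀ s, σ s = globalSection f k W s)
    (hWF : deligne1982_weilFamily_hodgeWeilSection)
    (hT : ∀ ⦃𝒳 S : SchemeOver ℂ⦄ (f : 𝒳 ⟶ S), IsSmoothProjectiveFamily f 8 →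
      (∃ (N : ℕ) (ι : 𝒳 ⟶ projectiveSpace N ℂ ⊗ S),
          IsClosedImmersion ι.left ∧ ι ≫ snd (projectiveSpace N ℂ) S = f) →
      IrreducibleSpace S.left → AlgebraicGeometry.Smooth S.hom → IsQuasiProjectiveOver S →
      ∀ (W : complexBetti 𝒳 8),
        (∀ s : ComplexPoints S, IsRationalClass (complexBetti.map (fiberι f s) 8 W) ∧
          IsOfHodgeType 8 (fiberOver f s) 8 4 4 (complexBetti.map (fiberι f s) 8 W)) →
        (∀ s : ComplexPoints S, ∃ (A' : AbelianVariety ℂ) (φ' : A' ⟶ A'),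
          A'.dim = 8 ∧ φ' ≫ φ' = -((7 : ℤ) • 𝟙 A') ∧ Nonempty (A'.X ≅ fiberOver f s)) →
        ∀ s₀ : ComplexPoints S,
          (∃ (Y : AbelianVariety ℂ) (Ψ : Y ⟶ Y) (e₀ : Y.X ≅ fiberOver f s₀) (A₁ : AbelianVariety ℂ)
              (f₁ : Y ⟶ A₁.prod A₁) (g₁ : A₁.prod A₁ ⟶ Y) (m : ℕ),
            A₁.dim = 4 ∧ Y.dim = 8 ∧ Ψ ≫ Ψ = -((7 : ℤ) • 𝟙 Y) ∧ 0 < m ∧ f₁ ≫ g₁ = m • 𝟙 Y ∧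
              Flat f₁.hom.hom.hom.left ∧
              g₁ ≫ Ψ = AbelianVariety.prodLift (AbelianVariety.snd A₁ A₁ ≫ (-((7 : ℤ) • 𝟙 A₁)))
                (AbelianVariety.fst A₁ A₁) ≫ g₁ ∧
              complexBetti.map e₀.hom 8 (complexBetti.map (fiberι f s₀) 8 W) ∈ weilClassesOf Y Ψ 4 7) →
          complexBetti.map (fiberι f s₀) 8 W ∈ algebraicClasses (fiberOver f s₀) 4 →
          ∀ s : ComplexPoints S, complexBetti.map (fiberι f s) 8 W ∈ algebraicClasses (fiberOver f s) 4) :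
    Summit.HodgeConjecture.HodgeConjecture.Theses.HeckePrymWeil.HyperbolicEightfoldsSqrtMinus7 := by
  intro A φ hA hφ _ _ _ _ _ c hr hH hW
  exact weilEightfolds_of_engine_of_weilFamily_of_transport hG hWF hT A φ hA hφ c hr hH hW

/-- **Tensor-anchored Weil transport in dimension 8 is an instance of the route crux
`WeilVariationalHodge`** (stmt-HodgeConjecture-14497) at `(p, M) = (7, 4)`: forget the embedding, the
quasi-projectivity and the anchor. -/
theorem tensorTransport_of_weilVariationalHodge
    (hV : Summit.HodgeConjecture.HodgeConjecture.Theses.HeckePrymWeil.WeilVariationalHodge) :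
    ∀ ⦃𝒳 S : SchemeOver ℂ⦄ (f : 𝒳 ⟶ S), IsSmoothProjectiveFamily f 8 →
      (∃ (N : ℕ) (ι : 𝒳 ⟶ projectiveSpace N ℂ ⊗ S),
          IsClosedImmersion ι.left ∧ ι ≫ snd (projectiveSpace N ℂ) S = f) →
      IrreducibleSpace S.left → AlgebraicGeometry.Smooth S.hom → IsQuasiProjectiveOver S →
      ∀ (W : complexBetti 𝒳 8),
        (∀ s : ComplexPoints S, IsRationalClass (complexBetti.map (fiberι f s) 8 W) ∧
          IsOfHodgeType 8 (fiberOver f s) 8 4 4 (complexBetti.map (fiberι f s) 8 W)) →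
        (∀ s : ComplexPoints S, ∃ (A' : AbelianVariety ℂ) (φ' : A' ⟶ A'),
          A'.dim = 8 ∧ φ' ≫ φ' = -((7 : ℤ) • 𝟙 A') ∧ Nonempty (A'.X ≅ fiberOver f s)) →
        ∀ s₀ : ComplexPoints S,
          (∃ (Y : AbelianVariety ℂ) (Ψ : Y ⟶ Y) (e₀ : Y.X ≅ fiberOver f s₀) (A₁ : AbelianVariety ℂ)
              (f₁ : Y ⟶ A₁.prod A₁) (g₁ : A₁.prod A₁ ⟶ Y) (m : ℕ),
            A₁.dim = 4 ∧ Y.dim = 8 ∧ Ψ ≫ Ψ = -((7 : ℤ) • 𝟙 Y) ∧ 0 < m ∧ f₁ ≫ g₁ = m • 𝟙 Y ∧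
              Flat f₁.hom.hom.hom.left ∧
              g₁ ≫ Ψ = AbelianVariety.prodLift (AbelianVariety.snd A₁ A₁ ≫ (-((7 : ℤ) • 𝟙 A₁)))
                (AbelianVariety.fst A₁ A₁) ≫ g₁ ∧
              complexBetti.map e₀.hom 8 (complexBetti.map (fiberι f s₀) 8 W) ∈ weilClassesOf Y Ψ 4 7) →
          complexBetti.map (fiberι f s₀) 8 W ∈ algebraicClasses (fiberOver f s₀) 4 →
          ∀ s : ComplexPoints S, complexBetti.map (fiberι f s) 8 W ∈ algebraicClasses (fiberOver f s) 4 := by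
  intro 𝒳 S f hf _ hirr hsm _ W hall hfib s₀ _ h0 s
  exact hV 7 (by norm_num) (by norm_num) le_rfl 4 (by norm_num) f hf hirr hsm W hall
    (fun s' => by
      obtain ⟨A', φ', h1, h2, h3⟩ := hfib s'
      exact ⟨A', φ', h1, by exact_mod_cast h2, h3⟩)
    ⟨s₀, h0⟩ s

/-- **Tensor-anchored Weil transport in dimension 8 is an instance of `AnchorTransport.VariationalHodge`**
(route AnchorTransport, stmt-HodgeConjecture-1076, the shared transport engine) at `p = 4`. -/
theorem tensorTransport_of_anchorTransport
    (hV : Summit.HodgeConjecture.HodgeConjecture.Theses.AnchorTransport.VariationalHodge) :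
    ∀ ⦃𝒳 S : SchemeOver ℂ⦄ (f : 𝒳 ⟶ S), IsSmoothProjectiveFamily f 8 →
      (∃ (N : ℕ) (ι : 𝒳 ⟶ projectiveSpace N ℂ ⊗ S),
          IsClosedImmersion ι.left ∧ ι ≫ snd (projectiveSpace N ℂ) S = f) →
      IrreducibleSpace S.left → AlgebraicGeometry.Smooth S.hom → IsQuasiProjectiveOver S →
      ∀ (W : complexBetti 𝒳 8),
        (∀ s : ComplexPoints S, IsRationalClass (complexBetti.map (fiberι f s) 8 W) ∧
          IsOfHodgeType 8 (fiberOver f s) 8 4 4 (complexBetti.map (fiberι f s) 8 W)) →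
        (∀ s : ComplexPoints S, ∃ (A' : AbelianVariety ℂ) (φ' : A' ⟶ A'),
          A'.dim = 8 ∧ φ' ≫ φ' = -((7 : ℤ) • 𝟙 A') ∧ Nonempty (A'.X ≅ fiberOver f s)) →
        ∀ s₀ : ComplexPoints S,
          (∃ (Y : AbelianVariety ℂ) (Ψ : Y ⟶ Y) (e₀ : Y.X ≅ fiberOver f s₀) (A₁ : AbelianVariety ℂ)
              (f₁ : Y ⟶ A₁.prod A₁) (g₁ : A₁.prod A₁ ⟶ Y) (m : ℕ),
            A₁.dim = 4 ∧ Y.dim = 8 ∧ Ψ ≫ Ψ = -((7 : ℤ) • 𝟙 Y) ∧ 0 < m ∧ f₁ ≫ g₁ = m • 𝟙 Y ∧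
              Flat f₁.hom.hom.hom.left ∧
              g₁ ≫ Ψ = AbelianVariety.prodLift (AbelianVariety.snd A₁ A₁ ≫ (-((7 : ℤ) • 𝟙 A₁)))
                (AbelianVariety.fst A₁ A₁) ≫ g₁ ∧
              complexBetti.map e₀.hom 8 (complexBetti.map (fiberι f s₀) 8 W) ∈ weilClassesOf Y Ψ 4 7) →
          complexBetti.map (fiberι f s₀) 8 W ∈ algebraicClasses (fiberOver f s₀) 4 →
          ∀ s : ComplexPoints S, complexBetti.map (fiberι f s) 8 W ∈ algebraicClasses (fiberOver f s) 4 := by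
  intro 𝒳 S f hf _ hirr hsm _ W hall _ s₀ _ h0 s
  exact hV f hf hirr hsm 4 W hall ⟨s₀, h0⟩ s

/-- **`HyperbolicEightfoldsSqrtMinus7` from three existing declarations of the tree**: the accepted named
facts `deligne1968_invariantClass_fromTotalSpace` (Deligne 1968 / Voisin II Thm. 4.18),
`deligne1982_weilFamily_hodgeWeilSection` (Deligne LNM 900, proof of Thm. 4.8) and the route crux
`WeilVariationalHodge` (stmt-HodgeConjecture-14497, OPEN) at `(7, 4)`. CONDITIONAL on exactly these.
[cite: Deligne1968, Prop. (2.1) with (2.6.3)] [cite: VoisinHodgeII2003, Thm. 4.18]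
[cite: Deligne1982HodgeCycles, proof of Thm. 4.8 (pp. 47–52) with Prop. 4.4, Lemma 4.5, Remark 4.10] -/
theorem hyperbolicEightfoldsSqrtMinus7_of_two_facts_of_weilVariationalHodge :
    Literature.AlgebraicGeometry.HodgeTheory.deligne1968_invariantClass_fromTotalSpace → Literature.AlgebraicGeometry.HodgeTheory.deligne1982_weilFamily_hodgeWeilSection → Summit.HodgeConjecture.HodgeConjecture.Theses.HeckePrymWeil.WeilVariationalHodge → Summit.HodgeConjecture.HodgeConjecture.Theses.HeckePrymWeil.HyperbolicEightfoldsSqrtMinus7 :=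
  fun hL hWF hV => hyperbolicEightfoldsSqrtMinus7_of_engine_of_weilFamily_of_transport
    (stub_globalClassOfSection_of_leray hL) hWF (tensorTransport_of_weilVariationalHodge hV)

/-- **`HyperbolicEightfoldsSqrtMinus7` from the two named facts and `AnchorTransport.VariationalHodge`**
(stmt-HodgeConjecture-1076). CONDITIONAL on exactly these. [cite: Deligne1968, Prop. (2.1) with (2.6.3)]
[cite: Deligne1982HodgeCycles, proof of Thm. 4.8 (pp. 47–52)] -/
theorem hyperbolicEightfoldsSqrtMinus7_of_two_facts_of_anchorTransport
    (hL : deligne1968_invariantClass_fromTotalSpace) (hWF : deligne1982_weilFamily_hodgeWeilSection)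
    (hV : Summit.HodgeConjecture.HodgeConjecture.Theses.AnchorTransport.VariationalHodge) :
    Summit.HodgeConjecture.HodgeConjecture.Theses.HeckePrymWeil.HyperbolicEightfoldsSqrtMinus7 :=
  hyperbolicEightfoldsSqrtMinus7_of_engine_of_weilFamily_of_transport
    (stub_globalClassOfSection_of_leray hL) hWF (tensorTransport_of_anchorTransport hV)

end Summit.HodgeConjecture.HodgeConjecture.Theorems.HyperbolicEightfoldsSqrtMinus7.TensorAnchor

end
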